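import Summits.ValiantsHypothesis.ValiantsHypothesis.Theorems.LacunarySymmetroidMatrixDescartesCensusDoorA34NullEndLift

/-!
# `MatrixDescartes` census — DOOR A at `(3,4)`: INTERIOR UNFOLDING of a touching root, and the NODE LAW

HONEST FRAMING.  Object-search cell `pub-symmetroid`, engine seat `val-sym-eng-2` (g13); helper row beside the registered strata line
`Cruxes/DoorA34/Lines/strata.lean` on stmt-ValiantsHypothesis-19980 (`DoorA34 = PosRootLawAt 3 4 18`: OPEN, typed, never asserted here), stubs
`stub_nullTopCeiling` / `stub_nullNullCeiling`.  The tree's END unfolding (`Census.nineteen_of_nullBottom_eighteen`, …NullEndLift: a singular end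
letter of adjugate rank unfolds one new root near `0`) has an INTERIOR companion, proved here for ALL supports and with NO hypothesis on the letters
other than the explicit non-degeneracy:

* §1 `altChain_replace_triple` — pure sign bookkeeping: if `p` carries an alternation chain `a₀ < … < a_N` and `g` has the sign of `p` at every
  `a_j` (`j ≠ k`), while at three new points `u < ρ < v` placed between `a_{k-1}` and `a_{k+1}` it has the signs `(+, −, +)·sign p(a_k)`, then `g`
  carries an alternation chain of length `N + 3` (the point `a_k` is replaced by the triple), hence `N + 2` distinct positive roots
  (`le_card_posRoots_replace_triple`).
* §2 `exists_altChain_add_C_mul_of_touch` — the perturbative form: `p(ρ) = 0` at a point `ρ` flanked by `u < ρ < v` where `p` has the sign of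
  `p(a_k)` (a TOUCHING zero inside the chain: even order, no alternation spent on it), and `q(ρ) ≠ 0`; then for a suitable real `η` the polynomial
  `p + η·q` carries a chain of length `N + 3`.
* §3 THE PENCIL FORM (`card_posRoots_perturb_ge_of_touch`): for a real `(3,4)` pencil `F(t) = Σ_l t^{d_l} S_l` whose determinant carries a chain of
  `N + 1` positive points and touches zero at such a `ρ`, and a vector `z` with `zᵀ·adj F(ρ)·z ≠ 0`, the pencil with bottom letter `S₀ + η·zzᵀ`
  (same support, symmetric if the `S_l` are) has `≥ N + 2` distinct positive det-roots for some `η` (`Census.det_pencil_perturb_rankOne`: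
  `det` changes by `η·X^{d₀}·zᵀ adj(F) z`, which is `≠ 0` at `ρ`).  With `N = 17`: ★ `nineteen_of_chain_touch`.
* §4 THE NODE LAW (`quadForm_adjugate_eq_zero_of_touch_of_posRootLawAt`, ★ `adjugate_eq_zero_of_touch_of_posRootLawAt`): IF `PosRootLawAt 3 4 18`
  (`= DoorA34`) holds, then in every real symmetric `(3,4)` pencil whose determinant carries an alternation chain of `18` positive points, a touching
  zero `ρ` placed as above is a NODE of the symmetroid on the monomial curve: `adj F(ρ) = 0`, i.e. `rank F(ρ) ≤ 1` (all `z` give `zᵀ adj F(ρ) z = 0`,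
  and the adjugate of a symmetric matrix is symmetric).  Equivalently: a hypothetical boundary configuration «17 crossings + 1 non-nodal double root»
  already yields a NINETEEN.  §5 the SHEET twin (`eighteen_on_sheet_of_chain_touch`): the perturbation leaves `S₃` untouched, so on the null-top sheet
  «16 crossings + 1 non-nodal touching zero» yields `18` on the sheet (the content `stub_nullTopCeiling` denies).

LOCATED COMPANION (this seat, report HOME/DOOR-A34-ENG2G13-REPORT.md §2–§3; exact letters, 50-digit certified numerics): on every located pseudo-nineteen
of the rail `(0,2,5,N)` (`V = 19`, `Z₊ = 17`) the complex root pair nearest the positive axis (the «ghost» of the unrealised alternation, `arg z ≈ 9/N`,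
beyond the largest real root) sits at a near-rank-one point of the pencil (`σ₂/σ₁(F(z)) = 3·10⁻³ … 7·10⁻⁷` against `≈ 0.3` at the realised roots), and
complex Gauss–Newton from `γ(z)` lands on an actual NODE of the symmetroid whose three curve parameters `(y_l/y_0)^{1/d_l}` agree to `≈ 1 %`:
the located maximisers press a node of the Cayley symmetroid against the monomial curve — exactly the configuration the node law leaves open.
Nothing here bounds any count; `DoorA34` and all three stubs stay OPEN; registers unchanged (`ζ_sym(3,4) ∈ {18,19}`); nothing on `MatrixDescartes`
(stmt-ValiantsHypothesis-18050) or `VP ≠ VNP` — VP≠VNP not moved.  [folklore] Intermediate value theorem / Descartes-type sign chains (tree: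
`AltChain`, `le_card_posRoots_of_altChain`), the matrix determinant lemma (tree: `det_pencil_perturb_rankOne`), polarisation; elementary.
-/

-- `Summit.ValiantsHypothesis.ValiantsHypothesis.…` repeats a component by the D-0017 layout
-- (single-conjunct summit), which the `dupNamespace` linter flags; the name is mandated.
set_option linter.dupNamespace false

namespace Summit.ValiantsHypothesis.ValiantsHypothesis.Theorems.LacunarySymmetroidMatrixDescartes.Census

open Polynomial Finset
open scoped BigOperators Polynomial Matrix
open Summit.ValiantsHypothesis.ValiantsHypothesis.Theorems.MatrixDescartes.Negative (PosRootLawAt)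

/-! ## §1 Replacing a chain point by a triple -/

/-- sign transfer: `0 < P·x`, `P·y < 0` ⟹ `x·y < 0`. [folklore] -/
theorem mul_neg_of_pos_of_neg_ref {P x y : ℝ} (hx : 0 < P * x) (hy : P * y < 0) : x * y < 0 := by
  have h1 : P * x * (P * y) < 0 := mul_neg_of_pos_of_neg hx hy
  have h2 : P * x * (P * y) = P ^ 2 * (x * y) := by ring
  rw [h2] at h1
  by_contra hc
  exact absurd h1 (not_lt.mpr (mul_nonneg (sq_nonneg P) (not_lt.mp hc)))

/-- **Chain surgery.**  Replace the point `a_k` of an alternation chain of `p` by a triple `u < ρ < v` (between the neighbours of `a_k`) at which a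
second polynomial `g` has signs `(sign p(a_k), −sign p(a_k), sign p(a_k))`, while `g` has the sign of `p` at every other chain point: the result is an
alternation chain of length `N + 3` for `g`. [folklore] -/
theorem altChain_replace_triple {p g : ℝ[X]} {N : ℕ} {s : ℝ} {a : Fin (N + 1) → ℝ} (h : AltChain p N s a) (k : Fin (N + 1))
    {u ρ v : ℝ} (hu0 : 0 < u) (huρ : u < ρ) (hρv : ρ < v)
    (hlo : ∀ j : Fin (N + 1), j.val + 1 = k.val → a j < u) (hhi : ∀ j : Fin (N + 1), j.val = k.val + 1 → v < a j)
    (hsame : ∀ j : Fin (N + 1), j ≠ k → 0 < p.eval (a j) * g.eval (a j))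
    (hgu : 0 < p.eval (a k) * g.eval u) (hgρ : p.eval (a k) * g.eval ρ < 0) (hgv : 0 < p.eval (a k) * g.eval v) :
    ∃ (s' : ℝ) (a' : Fin (N + 3) → ℝ), AltChain g (N + 2) s' a' := by
  obtain ⟨hmono, ha0, halt, _⟩ := h
  -- the chain read through `ℕ` (junk `0` beyond `N`) and the new sequence `a₀,…,a_{k-1}, u, ρ, v, a_{k+1},…,a_N`
  set e : ℕ → ℝ := fun n => if h : n < N + 1 then a ⟨n, h⟩ else 0 with he
  have extN_of_lt : ∀ {n : ℕ} (h : n < N + 1), e n = a ⟨n, h⟩ := fun {n} h => by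
    simp only [he]; rw [dif_pos h]
  set b : ℕ → ℝ := fun n => if n < k.val then e n else if n = k.val then u else if n = k.val + 1 then ρ
    else if n = k.val + 2 then v else e (n - 2) with hb
  have tripleSeq_of_lt : ∀ {n : ℕ}, n < k.val → b n = e n := fun {n} h => by
    simp only [hb]; rw [if_pos h]
  have tripleSeq_k : b k.val = u := by
    simp [hb]
  have tripleSeq_k1 : b (k.val + 1) = ρ := by
    simp [hb, show ¬ (k.val + 1 < k.val) from by omega]
  have tripleSeq_k2 : b (k.val + 2) = v := by
    simp [hb, show ¬ (k.val + 2 < k.val) from by omega]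
  have tripleSeq_of_gt : ∀ {n : ℕ}, k.val + 2 < n → b n = e (n - 2) := fun {n} h => by
    simp only [hb]; rw [if_neg (by omega), if_neg (by omega), if_neg (by omega), if_neg (by omega)]
  -- consecutive steps of the new sequence, as an `ℕ`-statement
  have hstep : ∀ n, n + 1 < N + 3 → b n < b (n + 1) ∧ g.eval (b n) * g.eval (b (n + 1)) < 0 := by
    intro n hn
    have hk := k.isLt
    -- chain facts in `ℕ`-indexing
    have amono : ∀ i j (hi : i < N + 1) (hj : j < N + 1), i < j → a ⟨i, hi⟩ < a ⟨j, hj⟩ :=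
      fun i j hi hj hij => hmono (show (⟨i, hi⟩ : Fin (N + 1)) < ⟨j, hj⟩ from hij)
    have palt : ∀ i (hi : i + 1 < N + 1), p.eval (a ⟨i, by omega⟩) * p.eval (a ⟨i + 1, hi⟩) < 0 :=
      fun i hi => halt ⟨i, by omega⟩
    have gsame : ∀ i (hi : i < N + 1), i ≠ k.val → 0 < p.eval (a ⟨i, hi⟩) * g.eval (a ⟨i, hi⟩) :=
      fun i hi hik => hsame ⟨i, hi⟩ (fun heq => hik (by simpa using congrArg Fin.val heq))
    -- two old consecutive chain points (both kept): alternation transfers from `p` to `g`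
    have old : ∀ i (hi : i + 1 < N + 1), i ≠ k.val → i + 1 ≠ k.val →
        a ⟨i, by omega⟩ < a ⟨i + 1, hi⟩ ∧ g.eval (a ⟨i, by omega⟩) * g.eval (a ⟨i + 1, hi⟩) < 0 := by
      intro i hi h1 h2
      exact ⟨amono i (i + 1) (by omega) hi (by omega),
        mul_neg_of_sign_transfer (gsame i (by omega) h1) (gsame (i + 1) hi h2) (palt i hi)⟩
    rcases Nat.lt_or_ge (n + 1) k.val with h1 | h1
    · -- both below `k`
      rw [tripleSeq_of_lt (show n < k.val by omega), tripleSeq_of_lt h1,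
        extN_of_lt (show n < N + 1 by omega), extN_of_lt (show n + 1 < N + 1 by omega)]
      exact old n (by omega) (by omega) (by omega)
    rcases Nat.lt_or_ge n k.val with h2 | h2
    · -- `n = k - 1`, next point is `u`
      have hn1 : n + 1 = k.val := by omega
      rw [tripleSeq_of_lt h2, hn1, tripleSeq_k, extN_of_lt (show n < N + 1 by omega)]
      refine ⟨hlo ⟨n, by omega⟩ hn1, ?_⟩
      have hpn : p.eval (a ⟨n, by omega⟩) * p.eval (a k) < 0 := by
        have := palt n (by omega)
        have hk' : (⟨n + 1, by omega⟩ : Fin (N + 1)) = k := Fin.ext hn1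
        rwa [hk'] at this
      exact mul_neg_of_sign_transfer (gsame n (by omega) (by omega)) hgu hpn
    rcases eq_or_lt_of_le h2 with h3 | h3
    · -- `n = k`: `u < ρ`
      rw [← h3, tripleSeq_k, tripleSeq_k1]
      exact ⟨huρ, mul_neg_of_pos_of_neg_ref hgu hgρ⟩
    rcases Nat.lt_or_ge n (k.val + 2) with h4 | h4
    · -- `n = k + 1`: `ρ < v`
      have hn : n = k.val + 1 := by omega
      rw [hn, tripleSeq_k1, show k.val + 1 + 1 = k.val + 2 by omega, tripleSeq_k2]
      have := mul_neg_of_pos_of_neg_ref hgv hgρ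
      exact ⟨hρv, by rw [mul_comm]; exact this⟩
    rcases eq_or_lt_of_le h4 with h5 | h5
    · -- `n = k + 2`: `v < a_{k+1}`
      rw [← h5, tripleSeq_k2, tripleSeq_of_gt (show k.val + 2 < k.val + 2 + 1 by omega),
        show k.val + 2 + 1 - 2 = k.val + 1 by omega, extN_of_lt (show k.val + 1 < N + 1 by omega)]
      refine ⟨hhi ⟨k.val + 1, by omega⟩ rfl, ?_⟩
      have hpk : p.eval (a k) * p.eval (a ⟨k.val + 1, by omega⟩) < 0 := by
        have := palt k.val (by omega)
        have hk' : (⟨k.val, by omega⟩ : Fin (N + 1)) = k := Fin.ext rfl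
        rwa [hk'] at this
      exact mul_neg_of_sign_transfer hgv (gsame (k.val + 1) (by omega) (by omega)) hpk
    · -- both above `k + 2`
      rw [tripleSeq_of_gt h5, tripleSeq_of_gt (show k.val + 2 < n + 1 by omega),
        show n + 1 - 2 = (n - 2) + 1 by omega, extN_of_lt (show n - 2 < N + 1 by omega),
        extN_of_lt (show n - 2 + 1 < N + 1 by omega)]
      exact old (n - 2) (by omega) (by omega) (by omega)
  refine ⟨g.eval (b 0), fun j => b j.val, ?_, ?_, ?_, ?_⟩
  · refine Fin.strictMono_iff_lt_succ.2 fun j => ?_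
    simpa only [Fin.val_castSucc, Fin.val_succ] using (hstep j.val (by omega)).1
  · show 0 < b 0
    rcases Nat.eq_zero_or_pos k.val with hk0 | hk0
    · have hb0 : b 0 = u := by have := tripleSeq_k; rwa [hk0] at this
      rw [hb0]; exact hu0
    · rw [tripleSeq_of_lt hk0, extN_of_lt (show 0 < N + 1 by omega)]; exact ha0
  · intro j
    simpa only [Fin.val_castSucc, Fin.val_succ] using (hstep j.val (by omega)).2
  · have hne : g.eval (b 0) ≠ 0 := by
      intro h0
      have := (hstep 0 (by omega)).2
      rw [h0, zero_mul] at this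
      exact lt_irrefl _ this
    simpa using mul_self_pos.mpr hne

/-- Root-count form of the chain surgery: `g` has at least `N + 2` distinct positive roots. [folklore] -/
theorem le_card_posRoots_replace_triple {p g : ℝ[X]} {N : ℕ} {s : ℝ} {a : Fin (N + 1) → ℝ} (h : AltChain p N s a) (k : Fin (N + 1))
    {u ρ v : ℝ} (hu0 : 0 < u) (huρ : u < ρ) (hρv : ρ < v)
    (hlo : ∀ j : Fin (N + 1), j.val + 1 = k.val → a j < u) (hhi : ∀ j : Fin (N + 1), j.val = k.val + 1 → v < a j)
    (hsame : ∀ j : Fin (N + 1), j ≠ k → 0 < p.eval (a j) * g.eval (a j))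
    (hgu : 0 < p.eval (a k) * g.eval u) (hgρ : p.eval (a k) * g.eval ρ < 0) (hgv : 0 < p.eval (a k) * g.eval v) :
    N + 2 ≤ (g.roots.toFinset.filter (fun t => 0 < t)).card := by
  obtain ⟨s', a', hc⟩ := altChain_replace_triple h k hu0 huρ hρv hlo hhi hsame hgu hgρ hgv
  exact le_card_posRoots_of_altChain hc

/-! ## §2 The perturbative form: a touching zero unfolds under `p ↦ p + η q` when `q(ρ) ≠ 0` -/

/-- a perturbation smaller than `|x|` keeps the sign of `x`. [folklore] -/
theorem mul_add_pos_of_abs_lt {x e : ℝ} (h : |e| < |x|) : 0 < x * (x + e) := by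
  rcases le_or_gt 0 e with he | he <;> rcases le_or_gt 0 x with hx | hx
  · rw [abs_of_nonneg he, abs_of_nonneg hx] at h; nlinarith
  · rw [abs_of_nonneg he, abs_of_neg hx] at h; nlinarith
  · rw [abs_of_neg he, abs_of_nonneg hx] at h; nlinarith
  · rw [abs_of_neg he, abs_of_neg hx] at h; nlinarith

/-- **Interior unfolding (polynomial form).**  `p` carries a chain of `N + 1` positive points; `ρ` is a zero of `p` flanked by `u < ρ < v`
(between the neighbours of the chain point `a_k`) at which `p` has the sign of `p(a_k)` — a touching zero; `q(ρ) ≠ 0`.  Then some `p + η·q`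
carries an alternation chain of length `N + 3`, so has `≥ N + 2` distinct positive roots. [folklore] -/
theorem le_card_posRoots_add_C_mul_of_touch {p q : ℝ[X]} {N : ℕ} {s : ℝ} {a : Fin (N + 1) → ℝ} (h : AltChain p N s a) (k : Fin (N + 1))
    {u ρ v : ℝ} (hu0 : 0 < u) (huρ : u < ρ) (hρv : ρ < v)
    (hlo : ∀ j : Fin (N + 1), j.val + 1 = k.val → a j < u) (hhi : ∀ j : Fin (N + 1), j.val = k.val + 1 → v < a j)
    (hpu : 0 < p.eval (a k) * p.eval u) (hpρ : p.eval ρ = 0) (hpv : 0 < p.eval (a k) * p.eval v) (hq : q.eval ρ ≠ 0) :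
    ∃ η : ℝ, N + 2 ≤ ((p + C η * q).roots.toFinset.filter (fun t => 0 < t)).card := by
  classical
  -- the finitely many points where the sign of `p` must be kept
  set P : Finset ℝ := (Finset.univ.image a) ∪ {u, v} with hP
  set c : ℝ := p.eval (a k) * q.eval ρ with hc
  have hcne : c ≠ 0 := mul_ne_zero (altChain_eval_ne_zero' h k) hq
  set bound : ℝ → ℝ := fun x => |p.eval x| / (|c| * |q.eval x| + 1) with hbound
  have hpne : ∀ x ∈ P, p.eval x ≠ 0 := by
    intro x hx
    rcases Finset.mem_union.mp hx with hx | hx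
    · obtain ⟨j, -, rfl⟩ := Finset.mem_image.mp hx
      exact altChain_eval_ne_zero' h j
    · rcases Finset.mem_insert.mp hx with rfl | hx
      · intro h0; rw [h0, mul_zero] at hpu; exact lt_irrefl _ hpu
      · rw [Finset.mem_singleton] at hx; subst hx
        intro h0; rw [h0, mul_zero] at hpv; exact lt_irrefl _ hpv
  have hPne : P.Nonempty := ⟨u, by simp [hP]⟩
  have hbpos : ∀ x ∈ P, 0 < bound x := fun x hx =>
    div_pos (abs_pos.mpr (hpne x hx)) (by positivity)
  obtain ⟨ε, hε, hεle⟩ : ∃ ε : ℝ, 0 < ε ∧ ∀ x ∈ P, ε ≤ bound x := by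
    refine ⟨(P.image bound).min' (hPne.image bound), ?_, fun x hx => Finset.min'_le _ _ (Finset.mem_image_of_mem bound hx)⟩
    obtain ⟨x, hx, hfx⟩ := Finset.mem_image.mp (Finset.min'_mem (P.image bound) (hPne.image bound))
    rw [← hfx]; exact hbpos x hx
  set η : ℝ := -(ε * c) with hη
  refine ⟨η, ?_⟩
  -- sign keeping at the points of `P`
  have hkeep : ∀ x ∈ P, 0 < p.eval x * (p + C η * q).eval x := by
    intro x hx
    have h1 : |(C η * q).eval x| < |p.eval x| := by
      rw [eval_mul, eval_C, hη, abs_mul, abs_neg, abs_mul, abs_of_pos hε]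
      have hb := hεle x hx
      have hq0 : 0 ≤ |q.eval x| := abs_nonneg _
      have hden : 0 < |c| * |q.eval x| + 1 := by positivity
      have : ε * (|c| * |q.eval x| + 1) ≤ |p.eval x| := (le_div_iff₀ hden).mp hb
      nlinarith [abs_nonneg c]
    have := mul_add_pos_of_abs_lt h1
    simpa [eval_add] using this
  have memA : ∀ j, a j ∈ P := fun j => by simp [hP]
  have memu : u ∈ P := by simp [hP]
  have memv : v ∈ P := by simp [hP]
  refine le_card_posRoots_replace_triple h k hu0 huρ hρv hlo hhi (fun j _ => hkeep _ (memA j)) ?_ ?_ ?_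
  · exact pos_of_mul_pos_both (hkeep u memu) hpu (altChain_eval_ne_zero' h k)
  · have : (p + C η * q).eval ρ = η * q.eval ρ := by simp [eval_add, hpρ]
    rw [this, hη]
    have : p.eval (a k) * (-(ε * c) * q.eval ρ) = -ε * c ^ 2 := by rw [hc]; ring
    rw [this]
    have : 0 < c ^ 2 := by positivity
    nlinarith
  · exact pos_of_mul_pos_both (hkeep v memv) hpv (altChain_eval_ne_zero' h k)
where
  /-- chain points are not roots. [folklore] -/
  altChain_eval_ne_zero' {p : ℝ[X]} {N : ℕ} {s : ℝ} {a : Fin (N + 1) → ℝ} (h : AltChain p N s a) (i : Fin (N + 1)) :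
      p.eval (a i) ≠ 0 := by
    obtain ⟨-, -, halt, hanc⟩ := h
    intro h0
    rcases Nat.lt_or_ge i.val N with hi | hi
    · have := halt ⟨i.val, hi⟩
      have hc : (⟨i.val, hi⟩ : Fin N).castSucc = i := Fin.ext rfl
      rw [hc, h0, zero_mul] at this; exact lt_irrefl _ this
    · rcases Nat.eq_zero_or_pos N with hN | hN
      · subst hN
        have hi0 : i = 0 := Fin.ext (by omega)
        rw [hi0] at h0; rw [h0, mul_zero] at hanc; exact lt_irrefl _ hanc
      · have := halt ⟨N - 1, by omega⟩
        have hc : (⟨N - 1, by omega⟩ : Fin N).succ = i := Fin.ext (by simp; omega)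
        rw [hc, h0, mul_zero] at this; exact lt_irrefl _ this
  /-- from `0 < P·g(x)`-type data: `0 < p(x)·g(x)` and `0 < P·p(x)` give `0 < P·g(x)` (`P ≠ 0`). [folklore] -/
  pos_of_mul_pos_both {P px gx : ℝ} (h1 : 0 < px * gx) (h2 : 0 < P * px) (_hP : P ≠ 0) : 0 < P * gx := by
    have h3 : 0 < px * gx * (P * px) := mul_pos h1 h2
    have h4 : px * gx * (P * px) = px ^ 2 * (P * gx) := by ring
    rw [h4] at h3
    exact pos_of_mul_pos_right h3 (sq_nonneg px)

/-! ## §3 The pencil form: bottom-letter rank-one perturbation along `z` with `zᵀ adj F(ρ) z ≠ 0` -/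

/-- evaluating the adjugate quadratic form of the pencil at a real point. [folklore] -/
theorem eval_dotProduct_adjugate_pencil_mulVec (d : Fin 4 → ℕ) (S : Fin 4 → Matrix (Fin 3) (Fin 3) ℝ) (z : Fin 3 → ℝ) (ρ : ℝ) :
    ((fun i => C (z i)) ⬝ᵥ ((∑ l, (X : ℝ[X]) ^ d l • (S l).map C).adjugate *ᵥ (fun i => C (z i)))).eval ρ
      = z ⬝ᵥ ((∑ l, ρ ^ d l • S l).adjugate *ᵥ z) := by
  set φ : ℝ[X] →+* ℝ := Polynomial.evalRingHom ρ with hφ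
  have hz : (⇑φ ∘ fun i => C (z i)) = z := by funext i; simp [hφ]
  have hM : φ.mapMatrix (∑ l, (X : ℝ[X]) ^ d l • (S l).map C) = ∑ l, ρ ^ d l • S l := by
    rw [map_sum]
    refine Finset.sum_congr rfl fun l _ => ?_
    ext i j
    simp [hφ, Matrix.map_apply, Matrix.smul_apply]
    exact mul_comm _ _
  have hmv : (⇑φ ∘ ((∑ l, (X : ℝ[X]) ^ d l • (S l).map C).adjugate *ᵥ fun i => C (z i)))
      = (∑ l, ρ ^ d l • S l).adjugate *ᵥ z := by
    funext i
    rw [Function.comp_apply, RingHom.map_mulVec, hz, ← RingHom.mapMatrix_apply, RingHom.map_adjugate, hM]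
  rw [← Polynomial.coe_evalRingHom, ← hφ, RingHom.map_dotProduct, hmv, hz]

/-- **INTERIOR UNFOLDING (pencil form).**  A real `(3,4)` pencil whose determinant carries an alternation chain of `N + 1` positive points and
TOUCHES zero at `ρ` (flanked inside the chain as in §2), and a vector `z` with `zᵀ·adj F(ρ)·z ≠ 0`: for some real `η` the pencil with bottom letter
`S₀ + η·zzᵀ` (same support) has at least `N + 2` distinct positive det-roots. [folklore] -/
theorem card_posRoots_perturb_ge_of_touch (d : Fin 4 → ℕ) (S : Fin 4 → Matrix (Fin 3) (Fin 3) ℝ)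
    {N : ℕ} {s : ℝ} {a : Fin (N + 1) → ℝ} (h : AltChain ((∑ l, (X : ℝ[X]) ^ d l • (S l).map C).det) N s a) (k : Fin (N + 1))
    {u ρ v : ℝ} (hu0 : 0 < u) (huρ : u < ρ) (hρv : ρ < v)
    (hlo : ∀ j : Fin (N + 1), j.val + 1 = k.val → a j < u) (hhi : ∀ j : Fin (N + 1), j.val = k.val + 1 → v < a j)
    (hpu : 0 < (∑ l, (a k) ^ d l • S l).det * (∑ l, u ^ d l • S l).det)
    (hpρ : (∑ l, ρ ^ d l • S l).det = 0)
    (hpv : 0 < (∑ l, (a k) ^ d l • S l).det * (∑ l, v ^ d l • S l).det)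
    (z : Fin 3 → ℝ) (hz : z ⬝ᵥ ((∑ l, ρ ^ d l • S l).adjugate *ᵥ z) ≠ 0) :
    ∃ η : ℝ, N + 2 ≤ ((((∑ l, (X : ℝ[X]) ^ d l •
      ((S l + if l = 0 then η • Matrix.vecMulVec z z else 0)).map C)).det).roots.toFinset.filter (fun t => 0 < t)).card := by
  set p : ℝ[X] := (∑ l, (X : ℝ[X]) ^ d l • (S l).map C).det with hp
  set q : ℝ[X] := X ^ d 0 * ((fun i => C (z i)) ⬝ᵥ ((∑ l, (X : ℝ[X]) ^ d l • (S l).map C).adjugate *ᵥ (fun i => C (z i)))) with hq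
  have hev : ∀ t : ℝ, p.eval t = (∑ l, t ^ d l • S l).det := fun t => SymmetroidDescartes.eval_det_pencil S d t
  have hqρ : q.eval ρ ≠ 0 := by
    rw [hq, eval_mul, eval_pow, eval_X, eval_dotProduct_adjugate_pencil_mulVec]
    exact mul_ne_zero (pow_ne_zero _ (hu0.trans huρ).ne') hz
  obtain ⟨η, hη⟩ := le_card_posRoots_add_C_mul_of_touch h k hu0 huρ hρv hlo hhi (by rwa [hev, hev]) (by rw [hev, hpρ]) (by rwa [hev, hev]) hqρ
  exact ⟨η, by rwa [det_pencil_perturb_rankOne, ← hp, ← hq]⟩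

/-- ★ **NINETEEN FROM «17 CROSSINGS + A NON-NODAL TOUCH».**  A real `(3,4)` pencil with an alternation chain of `18` positive points, a touching
zero `ρ` inside the chain, and `zᵀ adj F(ρ) z ≠ 0` for some `z`, unfolds (bottom letter `S₀ + η zzᵀ`, same support; symmetric letters stay
symmetric) to a pencil with `≥ 19` distinct positive det-roots. [folklore] -/
theorem nineteen_of_chain_touch (d : Fin 4 → ℕ) (S : Fin 4 → Matrix (Fin 3) (Fin 3) ℝ)
    {s : ℝ} {a : Fin 18 → ℝ} (h : AltChain ((∑ l, (X : ℝ[X]) ^ d l • (S l).map C).det) 17 s a) (k : Fin 18)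
    {u ρ v : ℝ} (hu0 : 0 < u) (huρ : u < ρ) (hρv : ρ < v)
    (hlo : ∀ j : Fin 18, j.val + 1 = k.val → a j < u) (hhi : ∀ j : Fin 18, j.val = k.val + 1 → v < a j)
    (hpu : 0 < (∑ l, (a k) ^ d l • S l).det * (∑ l, u ^ d l • S l).det) (hpρ : (∑ l, ρ ^ d l • S l).det = 0)
    (hpv : 0 < (∑ l, (a k) ^ d l • S l).det * (∑ l, v ^ d l • S l).det)
    (z : Fin 3 → ℝ) (hz : z ⬝ᵥ ((∑ l, ρ ^ d l • S l).adjugate *ᵥ z) ≠ 0) :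
    ∃ η : ℝ, 19 ≤ ((((∑ l, (X : ℝ[X]) ^ d l •
      ((S l + if l = 0 then η • Matrix.vecMulVec z z else 0)).map C)).det).roots.toFinset.filter (fun t => 0 < t)).card :=
  card_posRoots_perturb_ge_of_touch d S h k hu0 huρ hρv hlo hhi hpu hpρ hpv z hz

/-! ## §4 The node law under `PosRootLawAt 3 4 18` (`= DoorA34`, OPEN) -/

/-- **NODE LAW, quadratic-form version.**  If `PosRootLawAt 3 4 18` holds, then for every real SYMMETRIC `(3,4)` pencil whose determinant carries
an alternation chain of `18` positive points, at every touching zero `ρ` flanked inside the chain the adjugate quadratic form vanishes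
identically: `zᵀ adj F(ρ) z = 0` for all `z`. [folklore] -/
theorem quadForm_adjugate_eq_zero_of_touch_of_posRootLawAt (hlaw : PosRootLawAt 3 4 18)
    (d : Fin 4 → ℕ) (S : Fin 4 → Matrix (Fin 3) (Fin 3) ℝ) (hS : ∀ l, (S l).IsSymm)
    {s : ℝ} {a : Fin 18 → ℝ} (h : AltChain ((∑ l, (X : ℝ[X]) ^ d l • (S l).map C).det) 17 s a) (k : Fin 18)
    {u ρ v : ℝ} (hu0 : 0 < u) (huρ : u < ρ) (hρv : ρ < v)
    (hlo : ∀ j : Fin 18, j.val + 1 = k.val → a j < u) (hhi : ∀ j : Fin 18, j.val = k.val + 1 → v < a j)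
    (hpu : 0 < (∑ l, (a k) ^ d l • S l).det * (∑ l, u ^ d l • S l).det) (hpρ : (∑ l, ρ ^ d l • S l).det = 0)
    (hpv : 0 < (∑ l, (a k) ^ d l • S l).det * (∑ l, v ^ d l • S l).det) (z : Fin 3 → ℝ) :
    z ⬝ᵥ ((∑ l, ρ ^ d l • S l).adjugate *ᵥ z) = 0 := by
  by_contra hz
  obtain ⟨η, h19⟩ := nineteen_of_chain_touch d S h k hu0 huρ hρv hlo hhi hpu hpρ hpv z hz
  have := hlaw d (fun l => S l + if l = 0 then η • Matrix.vecMulVec z z else 0) (perturb_rankOne_isSymm S hS z η)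
  omega

/-- polarisation: a symmetric real `3 × 3` matrix whose quadratic form vanishes identically is zero. [folklore] -/
theorem eq_zero_of_isSymm_of_quadForm_eq_zero (B : Matrix (Fin 3) (Fin 3) ℝ) (hB : B.IsSymm)
    (h : ∀ z : Fin 3 → ℝ, z ⬝ᵥ (B *ᵥ z) = 0) : B = 0 := by
  have hs : ∀ i j, B j i = B i j := fun i j => by
    have := congrFun (congrFun hB i) j; simpa [Matrix.transpose_apply] using this
  have h1 := h ![1, 0, 0]
  have h2 := h ![0, 1, 0]
  have h3 := h ![0, 0, 1]
  have h12 := h ![1, 1, 0]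
  have h13 := h ![1, 0, 1]
  have h23 := h ![0, 1, 1]
  simp [Matrix.mulVec, dotProduct, Fin.sum_univ_three] at h1 h2 h3 h12 h13 h23
  ext i j
  fin_cases i <;> fin_cases j <;> simp <;> linarith [hs 0 1, hs 0 2, hs 1 2]

/-- a real point of a pencil of symmetric letters is symmetric, and so is its adjugate. [folklore] -/
theorem isSymm_adjugate_eval_pencil (d : Fin 4 → ℕ) {S : Fin 4 → Matrix (Fin 3) (Fin 3) ℝ} (hS : ∀ l, (S l).IsSymm) (ρ : ℝ) :
    (∑ l, ρ ^ d l • S l).adjugate.IsSymm := by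
  have hF : (∑ l, ρ ^ d l • S l).IsSymm := by
    unfold Matrix.IsSymm
    rw [Matrix.transpose_sum]
    exact Finset.sum_congr rfl fun l _ => by rw [Matrix.transpose_smul, (hS l).eq]
  unfold Matrix.IsSymm at hF ⊢
  rw [Matrix.adjugate_transpose, hF]

/-- ★ **THE NODE LAW.**  If `PosRootLawAt 3 4 18` (`= DoorA34`) holds, then in every real symmetric `(3,4)` pencil whose determinant carries an
alternation chain of `18` positive points, every touching zero `ρ` flanked inside the chain is a NODE of the symmetroid on the monomial curve:
`adj F(ρ) = 0`, i.e. `F(ρ)` has rank `≤ 1`.  (Contrapositive: «17 crossings + one non-nodal double root» is already a nineteen.) [folklore] -/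
theorem adjugate_eq_zero_of_touch_of_posRootLawAt (hlaw : PosRootLawAt 3 4 18)
    (d : Fin 4 → ℕ) (S : Fin 4 → Matrix (Fin 3) (Fin 3) ℝ) (hS : ∀ l, (S l).IsSymm)
    {s : ℝ} {a : Fin 18 → ℝ} (h : AltChain ((∑ l, (X : ℝ[X]) ^ d l • (S l).map C).det) 17 s a) (k : Fin 18)
    {u ρ v : ℝ} (hu0 : 0 < u) (huρ : u < ρ) (hρv : ρ < v)
    (hlo : ∀ j : Fin 18, j.val + 1 = k.val → a j < u) (hhi : ∀ j : Fin 18, j.val = k.val + 1 → v < a j)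
    (hpu : 0 < (∑ l, (a k) ^ d l • S l).det * (∑ l, u ^ d l • S l).det) (hpρ : (∑ l, ρ ^ d l • S l).det = 0)
    (hpv : 0 < (∑ l, (a k) ^ d l • S l).det * (∑ l, v ^ d l • S l).det) :
    (∑ l, ρ ^ d l • S l).adjugate = 0 :=
  eq_zero_of_isSymm_of_quadForm_eq_zero _ (isSymm_adjugate_eval_pencil d hS ρ)
    (quadForm_adjugate_eq_zero_of_touch_of_posRootLawAt hlaw d S hS h k hu0 huρ hρv hlo hhi hpu hpρ hpv)

/-! ## §5 The sheet twin: the unfolding keeps the top letter -/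

/-- **INTERIOR UNFOLDING ON THE SHEET.**  Same statement with the information that the top letter is untouched: on the null-top sheet
(`det S₃ = 0`) a chain of `17` positive points plus a non-nodal touching zero yields a SYMMETRIC pencil ON THE SHEET with `≥ 18` distinct positive
det-roots — the configuration `stub_nullTopCeiling` (null-top `≤ 17`) must therefore exclude. [folklore] -/
theorem eighteen_on_sheet_of_chain_touch (d : Fin 4 → ℕ) (S : Fin 4 → Matrix (Fin 3) (Fin 3) ℝ) (hS : ∀ l, (S l).IsSymm)
    (h3 : (S 3).det = 0)
    {s : ℝ} {a : Fin 17 → ℝ} (h : AltChain ((∑ l, (X : ℝ[X]) ^ d l • (S l).map C).det) 16 s a) (k : Fin 17)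
    {u ρ v : ℝ} (hu0 : 0 < u) (huρ : u < ρ) (hρv : ρ < v)
    (hlo : ∀ j : Fin 17, j.val + 1 = k.val → a j < u) (hhi : ∀ j : Fin 17, j.val = k.val + 1 → v < a j)
    (hpu : 0 < (∑ l, (a k) ^ d l • S l).det * (∑ l, u ^ d l • S l).det) (hpρ : (∑ l, ρ ^ d l • S l).det = 0)
    (hpv : 0 < (∑ l, (a k) ^ d l • S l).det * (∑ l, v ^ d l • S l).det)
    (z : Fin 3 → ℝ) (hz : z ⬝ᵥ ((∑ l, ρ ^ d l • S l).adjugate *ᵥ z) ≠ 0) :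
    ∃ S' : Fin 4 → Matrix (Fin 3) (Fin 3) ℝ, (∀ l, (S' l).IsSymm) ∧ (S' 3).det = 0 ∧
      18 ≤ (((∑ l, (X : ℝ[X]) ^ d l • (S' l).map C).det).roots.toFinset.filter (fun t => 0 < t)).card := by
  obtain ⟨η, h18⟩ := card_posRoots_perturb_ge_of_touch d S h k hu0 huρ hρv hlo hhi hpu hpρ hpv z hz
  refine ⟨fun l => S l + if l = 0 then η • Matrix.vecMulVec z z else 0, perturb_rankOne_isSymm S hS z η, ?_, h18⟩
  show (S 3 + if (3 : Fin 4) = 0 then η • Matrix.vecMulVec z z else 0).det = 0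
  rw [if_neg (by decide), add_zero, h3]

end Summit.ValiantsHypothesis.ValiantsHypothesis.Theorems.LacunarySymmetroidMatrixDescartes.Census
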